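import Summits.QuantumFields.BalabanUV.T4Continuum.Support.DirichletCaccioppoli
import Summits.QuantumFields.BalabanUV.T4Continuum.Support.CoordAnnulusPoincare

/-!
# `BalabanUV.T4Continuum.Support.DirichletHoleFillingCutoff` — NE2 (node U1a) formalisation swarm, sub-row `T4-U1a.S-NE2-D1-DIRICHLET°`,
# supplier item «Δ1-HOLEFILL» (brick H-C, part 1a of 2): THE CHART OF THE COORDINATE CUBE INTO THE TORUS AND THE RAMP CUTOFF of Widman's
# hole-filling step (unit b2b-balaban-t4-ne2-formalise-leaf-08, gen 6, file 4a — split off file 4 for the 400-line rule)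

HONEST FRAMING.  Rung (B)+1 bookkeeping at MODEL level (finite torus, one lattice field); [folklore] lattice De Giorgi–Widman; NE2 (U1a) is
NOT proved by this file; spine PROVED 0/9 unchanged; NOT infinite volume, NOT the mass gap, NOT Clay.  HONEST DEPENDENCY (verbatim):
«continuum YM on T⁴ ⇐ BetaPertH ∧ nine spine estimates (0/9 proved); BetaPertH ⇐ (D1) ∧ (D4) ∧ CAP+tail; G-an2-4 gates asym, D1 and NE2/3/4.»

WHAT THIS FILE PROVES (0 sorry).  Torus `Tor N`, lattice factor `c ≠ 0`, the tree's `∂_ν = c(S_ν − 1)`, `Δ = Σ ∂ᴴ∂` (`B5Action121`):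
 * §1 the CHART `chart b j = b + j` of the coordinate cube `Fin d → Fin (n+1)` at a base point `b` (injective once `n + 1 ≤ N ν`; steps go to
   steps) and the pull-back of torus sums supported in its image;
 * §2 the RAMP `ramp k i = min(1, i/(k−1), (4k−1−i)/(k−1))` (`= 1` on `[k−1, 3k]`, `= 0` at both ends, `1/(k−1)`-Lipschitz, constant across
   every bond not inside a slab), the product cutoff `ψ j = Π_λ ramp k (j λ)` and its push-forward `η` to the torus (`0` off the chart);
 The step itself (`hole_filling_step`) is file 4b `DirichletHoleFilling`.

WHY (memo `t4/T4-EST-NE2-D1-LOCAL.md` §5).  Iterated over dyadic cubes (file 5, `DirichletMorreyDecay`) this is Morrey decay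
`E(z; cube ρ) ≲ (ρ/ρ₀)^{2s_d}`, `s_d = ½·log₂ θ_d⁻¹ > 0`, at every boundary vertex of every union of unit blocks — the input that bounds the
near-vertex piece of the second-difference budget at the located residue of «Δ1-LOCAL» (conflict patches) trivially.  The rate is honest and
tiny (constants are generous and not optimised); the point is that it is POSITIVE, EXPLICIT and GEOMETRY-FREE.

ABSOLUTE RULE (cell, verbatim): «No internally-minted statement may enter as a cited fact. Every hypothesis is either kernel-proved in
this package or a verbatim quotation of a PUBLISHED theorem with page reference. The manuscript(s) under audit are NOT citable for
their own disputed steps — they are the thing under adjudication; programme-internal (2001/route/tribunal) claims are never citable.»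
[folklore]; plain data `def`s (`chart`, `ramp`, `psi`, `eta`, `Kd`, `theta`), no `def … : Prop` fact.  NOT CLAIMED: anything at the residue
beyond this decay input; the two-level law on conflict patches; NE2; NE3.
-/

noncomputable section

open scoped BigOperators ComplexConjugate Matrix
open Finset

namespace Summit.QuantumFields.BalabanUV.T4Continuum.DirichletHoleFillingCutoff

open Literature.MathematicalPhysics.QuantumFieldTheory.Balaban1983to89.B5Prop11Plancherel (Tor unitVec)
open Literature.MathematicalPhysics.QuantumFieldTheory.Balaban1983to89.B5Action121 (sdiff LapS sdiff_mulVec)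
open Literature.MathematicalPhysics.QuantumFieldTheory.Balaban1983to89.Beta.CoordCubePoincare (stepUp)
open Summit.QuantumFields.BalabanUV.T4Continuum.DirichletDirectionalBesov (star_dotProduct_eq_sum restrictTo)
open Summit.QuantumFields.BalabanUV.T4Continuum.DirichletDirectionalBesovCutoff (cut)
open Summit.QuantumFields.BalabanUV.T4Continuum.DirichletCaccioppoli (caccioppoli_region)
open Summit.QuantumFields.BalabanUV.T4Continuum.FiniteVarianceGluing (sum_union_le_add)
open Summit.QuantumFields.BalabanUV.T4Continuum.CoordSlabPoincare
open Summit.QuantumFields.BalabanUV.T4Continuum.CoordSlabPoincareHi (hi mem_hi)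
open Summit.QuantumFields.BalabanUV.T4Continuum.CoordOctantBoxes (oct sum_norm_sq_cube_le)
open Summit.QuantumFields.BalabanUV.T4Continuum.CoordAnnulusPoincare (inner mem_inner slabDir annConst annulus_mass_le slabs_dir_le)

variable {d : ℕ} (N : Fin d → ℕ) [hN : ∀ μ, NeZero (N μ)] {n : ℕ}

/-! ## §1 The chart and the pull-back of sums -/

/-- the CHART of the coordinate cube at the base point `b`: `j ↦ b + j`. [folklore] -/
def chart (b : Tor N) (j : Fin d → Fin (n + 1)) : Tor N := b + fun ν => ((j ν : ℕ) : ZMod (N ν))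

omit hN in
/-- steps go to steps: `chart (j + e_ν) = chart j + e_ν` off the last `ν`-layer. [folklore] -/
theorem chart_stepUp (b : Tor N) {j : Fin d → Fin (n + 1)} {ν : Fin d} (hj : j ν ≠ Fin.last n) :
    chart N b (stepUp j ν) = chart N b j + unitVec N ν := by
  funext l
  simp only [chart, Pi.add_apply, unitVec]
  by_cases hl : l = ν
  · subst hl
    rw [Pi.single_eq_same, val_stepUp hj, Nat.cast_succ, add_assoc]
  · rw [Pi.single_eq_of_ne hl, stepUp_apply_ne _ hl, add_zero]

omit hN in
/-- the chart is injective once the cube fits into the torus (`n + 1 ≤ N ν`). [folklore] -/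
theorem chart_injective (b : Tor N) (hn : ∀ ν, n + 1 ≤ N ν) : Function.Injective (chart N b (n := n)) := by
  intro j j' h
  funext ν
  have h1 := congrFun h ν
  simp only [chart, Pi.add_apply, add_right_inj] at h1
  have h2 := congrArg ZMod.val h1
  rw [ZMod.val_natCast_of_lt (lt_of_lt_of_le (j ν).isLt (hn ν)), ZMod.val_natCast_of_lt (lt_of_lt_of_le (j' ν).isLt (hn ν))] at h2
  exact Fin.ext h2

/-- **PULL-BACK**: a torus sum against a push-forward is a cube sum (no injectivity needed). [folklore] -/
theorem sum_pull (b : Tor N) (s : Finset (Fin d → Fin (n + 1))) (a : (Fin d → Fin (n + 1)) → ℝ) (G : Tor N → ℝ) :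
    ∑ x : Tor N, (∑ j ∈ s, if chart N b j = x then a j else 0) * G x = ∑ j ∈ s, a j * G (chart N b j) := by
  simp_rw [Finset.sum_mul]
  rw [Finset.sum_comm]
  refine Finset.sum_congr rfl fun j _ => ?_
  simp_rw [ite_mul, zero_mul]
  rw [Finset.sum_ite_eq]
  simp

omit hN in
/-- the square of a push-forward by an INJECTIVE chart is the push-forward of the squares. [folklore] -/
theorem sq_sum_ite (b : Tor N) (hn : ∀ ν, n + 1 ≤ N ν) (s : Finset (Fin d → Fin (n + 1))) (a : (Fin d → Fin (n + 1)) → ℝ) (x : Tor N) :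
    (∑ j ∈ s, if chart N b j = x then a j else 0) ^ 2 = ∑ j ∈ s, if chart N b j = x then a j ^ 2 else 0 := by
  by_cases h : ∃ j ∈ s, chart N b j = x
  · obtain ⟨j, hj, hjx⟩ := h
    have huniq : ∀ j' ∈ s, j' ≠ j → chart N b j' ≠ x := fun j' _ hne heq =>
      hne (chart_injective N b hn (heq.trans hjx.symm))
    rw [Finset.sum_eq_single_of_mem j hj (fun j' hj' hne => if_neg (huniq j' hj' hne)),
      Finset.sum_eq_single_of_mem j hj (fun j' hj' hne => if_neg (huniq j' hj' hne)), if_pos hjx, if_pos hjx]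
  · push Not at h
    rw [Finset.sum_eq_zero (fun j hj => if_neg (h j hj)), Finset.sum_eq_zero (fun j hj => if_neg (h j hj))]
    ring

/-- a torus sum of a non-negative function dominates its sum over the image of a cube set. [folklore] -/
theorem sum_chart_le_sum (b : Tor N) (hn : ∀ ν, n + 1 ≤ N ν) (s : Finset (Fin d → Fin (n + 1))) {G : Tor N → ℝ} (hG : ∀ x, 0 ≤ G x) :
    ∑ j ∈ s, G (chart N b j) ≤ ∑ x : Tor N, G x := by
  rw [← Finset.sum_image (f := fun x => G x) (fun j _ j' _ h => chart_injective N b hn h)]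
  exact Finset.sum_le_sum_of_subset_of_nonneg (Finset.subset_univ _) fun x _ _ => hG x

/-! ## §2 The ramp, the product cutoff and its push-forward -/

section Cutoff

variable (k : ℕ)

/-- the RAMP profile `min(1, i/(k−1), (4k−1−i)/(k−1))`. [folklore] -/
def ramp (i : ℕ) : ℝ := min 1 (min ((i : ℝ) / ((k : ℝ) - 1)) ((4 * (k : ℝ) - 1 - i) / ((k : ℝ) - 1)))

/-- `0 ≤ ramp` on `[0, 4k − 1]` (for `k ≥ 2`). [folklore] -/
theorem ramp_nonneg (hk : 2 ≤ k) {i : ℕ} (hi : i + 1 ≤ 4 * k) : 0 ≤ ramp k i := by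
  have hk1 : (0 : ℝ) < (k : ℝ) - 1 := by
    have : (2 : ℝ) ≤ k := by exact_mod_cast hk
    linarith
  have h4 : (0 : ℝ) ≤ 4 * (k : ℝ) - 1 - i := by
    have : ((i + 1 : ℕ) : ℝ) ≤ ((4 * k : ℕ) : ℝ) := by exact_mod_cast hi
    push_cast at this; linarith
  unfold ramp
  refine le_min zero_le_one (le_min (by positivity) (div_nonneg h4 hk1.le))

omit k in
/-- `ramp ≤ 1`. [folklore] -/
theorem ramp_le_one (k i : ℕ) : ramp k i ≤ 1 := min_le_left _ _

/-- `ramp = 1` on `[k − 1, 3k]`. [folklore] -/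
theorem ramp_eq_one (hk : 2 ≤ k) {i : ℕ} (h1 : k ≤ i + 1) (h2 : i ≤ 3 * k) : ramp k i = 1 := by
  have hk1 : (0 : ℝ) < (k : ℝ) - 1 := by
    have : (2 : ℝ) ≤ k := by exact_mod_cast hk
    linarith
  have ha : (1 : ℝ) ≤ (i : ℝ) / ((k : ℝ) - 1) := by
    rw [le_div_iff₀ hk1]
    have : ((k : ℕ) : ℝ) ≤ ((i + 1 : ℕ) : ℝ) := by exact_mod_cast h1
    push_cast at this; linarith
  have hb : (1 : ℝ) ≤ (4 * (k : ℝ) - 1 - i) / ((k : ℝ) - 1) := by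
    rw [le_div_iff₀ hk1]
    have : ((i : ℕ) : ℝ) ≤ ((3 * k : ℕ) : ℝ) := by exact_mod_cast h2
    push_cast at this; linarith
  unfold ramp
  rw [min_eq_left (le_min ha hb)]

/-- `ramp 0 = 0`. [folklore] -/
theorem ramp_zero (hk : 2 ≤ k) : ramp k 0 = 0 := by
  have hk1 : (0 : ℝ) < (k : ℝ) - 1 := by
    have : (2 : ℝ) ≤ k := by exact_mod_cast hk
    linarith
  have hb : (0 : ℝ) ≤ (4 * (k : ℝ) - 1) / ((k : ℝ) - 1) := by
    apply div_nonneg _ hk1.le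
    have : (2 : ℝ) ≤ k := by exact_mod_cast hk
    linarith
  unfold ramp
  rw [Nat.cast_zero, zero_div, sub_zero, min_eq_left hb, min_eq_right zero_le_one]

/-- `ramp (4k − 1) = 0` (stated as `ramp n` with `4k = n + 1`). [folklore] -/
theorem ramp_last (hk : 2 ≤ k) {n : ℕ} (hn : 4 * k = n + 1) : ramp k n = 0 := by
  have hk1 : (0 : ℝ) < (k : ℝ) - 1 := by
    have : (2 : ℝ) ≤ k := by exact_mod_cast hk
    linarith
  have hz : (4 * (k : ℝ) - 1 - n) / ((k : ℝ) - 1) = 0 := by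
    have : ((4 * k : ℕ) : ℝ) = ((n + 1 : ℕ) : ℝ) := by rw [hn]
    push_cast at this
    rw [show 4 * (k : ℝ) - 1 - n = 0 by linarith, zero_div]
  have ha : (0 : ℝ) ≤ (n : ℝ) / ((k : ℝ) - 1) := by positivity
  unfold ramp
  rw [hz, min_eq_right ha, min_eq_right zero_le_one]

/-- `ramp` is `1/(k−1)`-LIPSCHITZ across a bond. [folklore] -/
theorem abs_ramp_sub_le (hk : 2 ≤ k) (i : ℕ) : |ramp k (i + 1) - ramp k i| ≤ 1 / ((k : ℝ) - 1) := by
  have hk1 : (0 : ℝ) < (k : ℝ) - 1 := by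
    have : (2 : ℝ) ≤ k := by exact_mod_cast hk
    linarith
  unfold ramp
  refine (abs_min_sub_min_le_max _ _ _ _).trans (max_le (by simp [hk1.le]) ?_)
  refine (abs_min_sub_min_le_max _ _ _ _).trans (max_le ?_ ?_)
  · rw [Nat.cast_succ, ← sub_div, show (i : ℝ) + 1 - i = 1 by ring, abs_of_nonneg (by positivity)]
  · rw [Nat.cast_succ, ← sub_div, show 4 * (k : ℝ) - 1 - (i + 1) - (4 * k - 1 - i) = -1 by ring, abs_div, abs_neg, abs_one,
      abs_of_pos hk1]

/-- `ramp` is CONSTANT across every bond that is not inside a slab: `k ≤ i + 1`, `i + 1 ≤ 3k ⇒ ramp (i+1) = ramp i`. [folklore] -/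
theorem ramp_succ_eq (hk : 2 ≤ k) {i : ℕ} (h1 : k ≤ i + 1) (h2 : i + 1 ≤ 3 * k) : ramp k (i + 1) = ramp k i := by
  rw [ramp_eq_one k hk (by omega) h2, ramp_eq_one k hk h1 (by omega)]

/-- the PRODUCT CUTOFF `ψ j = Π_λ ramp k (j λ)` on the coordinate cube. [folklore] -/
def psi (j : Fin d → Fin (n + 1)) : ℝ := ∏ lam : Fin d, ramp k (j lam : ℕ)

/-- `0 ≤ ψ` (for `4k = n + 1`, `k ≥ 2`). [folklore] -/
theorem psi_nonneg (hk : 2 ≤ k) (hn : 4 * k = n + 1) (j : Fin d → Fin (n + 1)) : 0 ≤ psi (n := n) k j :=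
  Finset.prod_nonneg fun lam _ => ramp_nonneg k hk (by have := (j lam).isLt; omega)

/-- `ψ ≤ 1`. [folklore] -/
theorem psi_le_one (hk : 2 ≤ k) (hn : 4 * k = n + 1) (j : Fin d → Fin (n + 1)) : psi (n := n) k j ≤ 1 :=
  Finset.prod_le_one (fun lam _ => ramp_nonneg k hk (by have := (j lam).isLt; omega)) fun lam _ => ramp_le_one k _

/-- `ψ = 1` on the inner cube `[k, 3k)^d`. [folklore] -/
theorem psi_eq_one_of_inner (hk : 2 ≤ k) (hn : 4 * k = n + 1) {j : Fin d → Fin (n + 1)} (hj : j ∈ inner (n := n) k) :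
    psi (n := n) k j = 1 := by
  rw [mem_inner] at hj
  exact Finset.prod_eq_one fun lam _ => ramp_eq_one k hk (by have := (hj lam).1; omega) (by have := (hj lam).2; omega)

/-- `ψ j = 0` when some digit is `0`. [folklore] -/
theorem psi_eq_zero_of_zero (hk : 2 ≤ k) {j : Fin d → Fin (n + 1)} {ν : Fin d} (h : (j ν : ℕ) = 0) : psi (n := n) k j = 0 :=
  Finset.prod_eq_zero (mem_univ ν) (by rw [h]; exact ramp_zero k hk)

/-- `ψ j = 0` when some digit is the last one. [folklore] -/
theorem psi_eq_zero_of_last (hk : 2 ≤ k) (hn : 4 * k = n + 1) {j : Fin d → Fin (n + 1)} {ν : Fin d} (h : j ν = Fin.last n) :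
    psi (n := n) k j = 0 :=
  Finset.prod_eq_zero (mem_univ ν) (by rw [h, Fin.val_last]; exact ramp_last k hk hn)

/-- the bond difference of `ψ` FACTORS through the ramp difference of the stepped digit. [folklore] -/
theorem psi_stepUp_sub (j : Fin d → Fin (n + 1)) {ν : Fin d} (hj : j ν ≠ Fin.last n) :
    psi (n := n) k (stepUp j ν) - psi k j
      = (ramp k ((j ν : ℕ) + 1) - ramp k (j ν : ℕ)) * ∏ lam ∈ univ.erase ν, ramp k (j lam : ℕ) := by
  rw [psi, psi, ← Finset.mul_prod_erase univ _ (mem_univ ν), ← Finset.mul_prod_erase univ (fun lam => ramp k (j lam : ℕ)) (mem_univ ν),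
    val_stepUp hj, Finset.prod_congr rfl (fun lam hlam => by rw [stepUp_apply_ne _ (Finset.ne_of_mem_erase hlam)]), ← sub_mul]

/-- hence `|ψ (j + e_ν) − ψ j| ≤ 1/(k−1)` … [folklore] -/
theorem abs_psi_stepUp_sub_le (hk : 2 ≤ k) (hn : 4 * k = n + 1) (j : Fin d → Fin (n + 1)) {ν : Fin d} (hj : j ν ≠ Fin.last n) :
    |psi (n := n) k (stepUp j ν) - psi k j| ≤ 1 / ((k : ℝ) - 1) := by
  have hk1 : (0 : ℝ) < (k : ℝ) - 1 := by
    have : (2 : ℝ) ≤ k := by exact_mod_cast hk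
    linarith
  rw [psi_stepUp_sub k j hj, abs_mul]
  have h1 := abs_ramp_sub_le k hk (j ν : ℕ)
  have h2 : |∏ lam ∈ univ.erase ν, ramp k (j lam : ℕ)| ≤ 1 := by
    rw [abs_of_nonneg (Finset.prod_nonneg fun lam _ => ramp_nonneg k hk (by have := (j lam).isLt; omega))]
    exact Finset.prod_le_one (fun lam _ => ramp_nonneg k hk (by have := (j lam).isLt; omega)) fun lam _ => ramp_le_one k _
  have h0 : 0 ≤ |ramp k ((j ν : ℕ) + 1) - ramp k (j ν : ℕ)| := abs_nonneg _
  calc |ramp k ((j ν : ℕ) + 1) - ramp k (j ν : ℕ)| * |∏ lam ∈ univ.erase ν, ramp k (j lam : ℕ)|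
      ≤ 1 / ((k : ℝ) - 1) * 1 := mul_le_mul h1 h2 (abs_nonneg _) (div_nonneg zero_le_one hk1.le)
    _ = _ := mul_one _

/-- … and `ψ (j + e_ν) = ψ j` unless the bond lies inside a slab of direction `ν` (`j ν + 1 < k` or `3k ≤ j ν`). [folklore] -/
theorem psi_stepUp_eq (hk : 2 ≤ k) (j : Fin d → Fin (n + 1)) {ν : Fin d} (hj : j ν ≠ Fin.last n)
    (h : ¬ ((j ν : ℕ) + 1 < k ∨ 3 * k ≤ (j ν : ℕ))) : psi (n := n) k (stepUp j ν) = psi k j := by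
  have := psi_stepUp_sub k j hj
  rw [ramp_succ_eq k hk (by omega) (by omega), sub_self, zero_mul, sub_eq_zero] at this
  exact this

variable (b : Tor N)

/-- the PUSH-FORWARD of `ψ` to the torus: `η (chart j) = ψ j`, `η = 0` off the chart. [folklore] -/
def eta (x : Tor N) : ℝ := ∑ j : Fin d → Fin (n + 1), if chart N b j = x then psi (n := n) k j else 0

omit hN in
/-- `η (chart j) = ψ j` (injective chart). [folklore] -/
theorem eta_chart (hN' : ∀ ν, n + 1 ≤ N ν) (j : Fin d → Fin (n + 1)) : eta N (n := n) k b (chart N b j) = psi (n := n) k j := by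
  rw [eta, Finset.sum_eq_single j (fun j' _ hne => if_neg (fun h => hne (chart_injective N b hN' h))) (fun h => absurd (mem_univ j) h),
    if_pos rfl]

omit hN in
/-- `0 ≤ η`. [folklore] -/
theorem eta_nonneg (hk : 2 ≤ k) (hn : 4 * k = n + 1) (x : Tor N) : 0 ≤ eta N (n := n) k b x :=
  Finset.sum_nonneg fun j _ => by split_ifs; exacts [psi_nonneg k hk hn j, le_rfl]

omit hN in
/-- `η ≤ Σ_j [chart j = x]` (so `η ≤ 1` and `η = 0` off the chart). [folklore] -/
theorem eta_le_indicator (hk : 2 ≤ k) (hn : 4 * k = n + 1) (x : Tor N) :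
    eta N (n := n) k b x ≤ ∑ j : Fin d → Fin (n + 1), if chart N b j = x then (1 : ℝ) else 0 :=
  Finset.sum_le_sum fun j _ => by split_ifs; exacts [psi_le_one k hk hn j, le_rfl]

omit hN in
/-- `η ≤ 1`. [folklore] -/
theorem eta_le_one (hk : 2 ≤ k) (hn : 4 * k = n + 1) (hN' : ∀ ν, n + 1 ≤ N ν) (x : Tor N) : eta N (n := n) k b x ≤ 1 := by
  refine (eta_le_indicator N k b hk hn x).trans ?_
  by_cases h : ∃ j : Fin d → Fin (n + 1), chart N b j = x
  · obtain ⟨j, hjx⟩ := h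
    rw [Finset.sum_eq_single j (fun j' _ hne => if_neg (fun h => hne (chart_injective N b hN' (h.trans hjx.symm))))
      (fun h => absurd (mem_univ j) h), if_pos hjx]
  · push Not at h
    rw [Finset.sum_eq_zero (fun j _ => if_neg (h j))]; exact zero_le_one

end Cutoff

end Summit.QuantumFields.BalabanUV.T4Continuum.DirichletHoleFillingCutoff

end
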